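import Summits.AtomisticToContinuum.Crystallization.Theses.HullExactificationCascade
import Summits.AtomisticToContinuum.Crystallization.Theorems.HullExactificationCascadeHullGoodEverywhereDefs
import Summits.AtomisticToContinuum.Crystallization.Theorems.HullExactificationCascadeZeroDefectDensityConverse
import Summits.AtomisticToContinuum.Crystallization.Theorems.HullExactificationCascadeZeroDefectDensityScaling
import Summits.AtomisticToContinuum.Crystallization.Theorems.HullExactificationCascadeZeroDefectDensityLinkLemma
import Summits.AtomisticToContinuum.Crystallization.Theorems.HullExactificationCascadeZeroDefectDensityLinkQ
import Summits.AtomisticToContinuum.Crystallization.Theorems.HullExactificationCascadeZeroDefectDensityOctahedronSq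
import Summits.AtomisticToContinuum.Crystallization.Theorems.HullExactificationCascadeZeroDefectDensityAsmShell
import Summits.AtomisticToContinuum.Crystallization.Theorems.HullExactificationCascadeZeroDefectDensityCapAtoms
import Literature.Geometry.DiscreteGeometry.KissingPatterns
import HarnessLib

/-!
# REDUCTION of the crux `ZeroDefectDensity` (stmt-AtomisticToContinuum-12086, route `HullExactificationCascade`)
# — line `birth`, lead c4: the kernel-checked composition of the reshaped skeleton, as a theorem of the tree

`zeroDefectDensity_reduction`: the crux follows from
* `hSKO` — SOFT KISSING ORDER a.e. (the registered energetic stub `stub_softKissingOrder`: in Lennard-Jones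
  ground states the fraction of particles admitting no scale `a > 0` at which every particle within `13/5·a`
  is `1/4000`-softly twelve-kissed with the gap `131/100·a` tends to `0` — the open, bond-order half of LJ
  crystallization; cf. `BondOrderTwelve` stmt-12079, `LJBondSpread` stmt-9207), and
* `hLHK` — VERBATIM `Summit.AtomisticToContinuum.Crystallization.Theses.BrittleRungDescent.LocalHalesKernel`
  (stmt-AtomisticToContinuum-9208, effective local Hales at tolerance `1/400`; open, own crux chain)
together with the still-open but provable-now registered stubs of the line passed as hypotheses (pins, coordsFcc, coordsHcp);
they are being proved by stub-workers and will be discharged in a successor of this file.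

Proof = the composition of `Cruxes/ZeroDefectDensity/Lines/birth.lean`: `tendsto_density_mono` reduces the crux
to `hSKO` through the pointwise theorem (scale `a` → scale `1` by `stub_scaling`; at scale `1`: local Hales at
the centre and its twelve neighbours (`hLHK`, hypotheses by `red_lhk_hypotheses`), cap atoms, pins, coordinates,
`siteGood_of_frameApprox`).  No `sorry`, no new axiom; the two hypotheses are displayed, not assumed silently.
-/

noncomputable section

namespace Summit.AtomisticToContinuum.Crystallization.Theorems.ZeroDefectDensityBirth

open Filter Topology

/-- Under two-shell `1/4000`-soft kissing at scale `1` about `u`, the hypotheses of `LocalHalesKernel` hold at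
`u` and at every soft neighbour of `u`. [folklore] -/
theorem red_lhk_hypotheses (S : Set (EuclideanSpace ℝ (Fin 3))) (u : EuclideanSpace ℝ (Fin 3)) (hS : (∀ v ∈ S, dist u v ≤ 13 / 5 → ((∀ w ∈ S, w ≠ v → 1 - 1 / 4000 ≤ dist v w ∧ (dist v w ≤ 1 + 1 / 4000 ∨ 131 / 100 ≤ dist v w)) ∧ {w ∈ S | w ≠ v ∧ dist v w ≤ 1 + 1 / 4000}.ncard = 12)))
    (z : EuclideanSpace ℝ (Fin 3)) (hz : z = u ∨ (z ∈ S ∧ dist u z ≤ 1 + 1 / 4000)) :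
    ∀ v ∈ S, dist z v ≤ 1 + 1 / 400 → ((∀ w ∈ S, w ≠ v → 1 - 1 / 400 ≤ dist v w ∧ (dist v w ≤ 1 + 1 / 400 ∨ 63 / 50 ≤ dist v w)) ∧ {w ∈ S | w ≠ v ∧ dist v w ≤ 1 + 1 / 400}.ncard = 12) := by
  intro v hv hzv
  have hzu : dist u z ≤ 1 + 1 / 4000 := by
    rcases hz with rfl | ⟨-, h⟩
    · rw [dist_self]; norm_num
    · exact h
  have huv : dist u v ≤ 13 / 5 := by
    have := dist_triangle u z v
    linarith
  obtain ⟨hsep, hcard⟩ := hS v hv huv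
  refine ⟨fun w hw hwv => ?_, ?_⟩
  · obtain ⟨h1, h2⟩ := hsep w hw hwv
    refine ⟨by linarith, ?_⟩
    rcases h2 with h2 | h2
    · left; linarith
    · right; linarith
  · have hset : {w ∈ S | w ≠ v ∧ dist v w ≤ 1 + 1 / 400} = {w ∈ S | w ≠ v ∧ dist v w ≤ 1 + 1 / 4000} := by
      ext w
      simp only [Set.mem_setOf_eq]
      constructor
      · rintro ⟨hw, hwv, hd⟩
        refine ⟨hw, hwv, ?_⟩
        rcases (hsep w hw hwv).2 with h | h
        · exact h
        · exfalso; linarith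
      · rintro ⟨hw, hwv, hd⟩
        exact ⟨hw, hwv, by linarith⟩
    rw [hset]
    exact hcard

/-- Norm band of a labelled shell point. [folklore] -/
theorem red_norm_band {S : Set (EuclideanSpace ℝ (Fin 3))} {u : EuclideanSpace ℝ (Fin 3)} (hu : u ∈ S)
    (hS : (∀ v ∈ S, dist u v ≤ 13 / 5 → ((∀ w ∈ S, w ≠ v → 1 - 1 / 4000 ≤ dist v w ∧ (dist v w ≤ 1 + 1 / 4000 ∨ 131 / 100 ≤ dist v w)) ∧ {w ∈ S | w ≠ v ∧ dist v w ≤ 1 + 1 / 4000}.ncard = 12))) {P : Finset (EuclideanSpace ℝ (Fin 3))}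
    (e : {w : EuclideanSpace ℝ (Fin 3) // w ∈ S ∧ w ≠ u ∧ dist u w ≤ 1 + 1 / 400} ≃ {q : EuclideanSpace ℝ (Fin 3) // q ∈ P})
    (q : {q : EuclideanSpace ℝ (Fin 3) // q ∈ P}) :
    1 - 1 / 4000 ≤ dist u (e.symm q).1 ∧ dist u (e.symm q).1 ≤ 1 + 1 / 4000 := by
  have hw := (e.symm q).2
  have hsep := (softKissed_self hu hS).1 _ hw.1 hw.2.1
  refine ⟨hsep.1, ?_⟩
  rcases hsep.2 with h | h
  · exact h
  · exfalso; linarith [hw.2.2]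

/-- Contact band of two labelled shell points adjacent in the pattern. [folklore] -/
theorem red_contact_band {S : Set (EuclideanSpace ℝ (Fin 3))} {u : EuclideanSpace ℝ (Fin 3)}
    (hS : (∀ v ∈ S, dist u v ≤ 13 / 5 → ((∀ w ∈ S, w ≠ v → 1 - 1 / 4000 ≤ dist v w ∧ (dist v w ≤ 1 + 1 / 4000 ∨ 131 / 100 ≤ dist v w)) ∧ {w ∈ S | w ≠ v ∧ dist v w ≤ 1 + 1 / 4000}.ncard = 12))) {P : Finset (EuclideanSpace ℝ (Fin 3))}
    (e : {w : EuclideanSpace ℝ (Fin 3) // w ∈ S ∧ w ≠ u ∧ dist u w ≤ 1 + 1 / 400} ≃ {q : EuclideanSpace ℝ (Fin 3) // q ∈ P})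
    (he : ∀ w w' : {w : EuclideanSpace ℝ (Fin 3) // w ∈ S ∧ w ≠ u ∧ dist u w ≤ 1 + 1 / 400}, w ≠ w' → (dist w.1 w'.1 ≤ 1 + 1 / 400 ↔ dist (e w).1 (e w').1 = 1))
    (q q' : {q : EuclideanSpace ℝ (Fin 3) // q ∈ P}) (h1 : dist q.1 q'.1 = 1) :
    1 - 1 / 4000 ≤ dist (e.symm q).1 (e.symm q').1 ∧ dist (e.symm q).1 (e.symm q').1 ≤ 1 + 1 / 4000 := by
  have hqq : q ≠ q' := by
    intro h; subst h; simp at h1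
  have hne : e.symm q ≠ e.symm q' := fun h => hqq (e.symm.injective h)
  have hle : dist (e.symm q).1 (e.symm q').1 ≤ 1 + 1 / 400 := by
    rw [he _ _ hne]
    simpa using h1
  have hw := (e.symm q).2
  have hw' := (e.symm q').2
  have hSK := hS _ hw.1 (by linarith [hw.2.2])
  have hne1 : (e.symm q').1 ≠ (e.symm q).1 := fun h => hne (Subtype.ext h).symm
  have hsep := hSK.1 _ hw'.1 hne1
  refine ⟨hsep.1, ?_⟩
  rcases hsep.2 with h | h
  · exact h
  · exfalso; linarith

/-- **Assembly** (pointwise rigidity): soft contact graph fcc/hcp at `u` + caps + two-shell soft kissing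
⇒ `SiteGood S u`, from the pins, the coordinates, the squared octahedron lemma, the quantitative link lemma and
`siteGood_of_frameApprox`. [folklore] -/
theorem red_assembly (hPins : ∀ (S : Set (EuclideanSpace ℝ (Fin 3))) (u : EuclideanSpace ℝ (Fin 3)), u ∈ S → (∀ v ∈ S, dist u v ≤ 13 / 5 → ((∀ w ∈ S, w ≠ v → 1 - 1 / 4000 ≤ dist v w ∧ (dist v w ≤ 1 + 1 / 4000 ∨ 131 / 100 ≤ dist v w)) ∧ {w ∈ S | w ≠ v ∧ dist v w ≤ 1 + 1 / 4000}.ncard = 12)) → ∀ (P : Finset (EuclideanSpace ℝ (Fin 3))), (P = Literature.Geometry.DiscreteGeometry.fccKissingPattern ∨ P = Literature.Geometry.DiscreteGeometry.hcpKissingPattern) → ∀ (e : {w : EuclideanSpace ℝ (Fin 3) // w ∈ S ∧ w ≠ u ∧ dist u w ≤ 1 + 1 / 400} ≃ {q : EuclideanSpace ℝ (Fin 3) // q ∈ P}), (∀ w w' : {w : EuclideanSpace ℝ (Fin 3) // w ∈ S ∧ w ≠ u ∧ dist u w ≤ 1 + 1 / 400}, w ≠ w' → (dist w.1 w'.1 ≤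 1 + 1 / 400 ↔ dist (e w).1 (e w').1 = 1)) → (∀ z₁ ∈ S, ∀ z₂ ∈ S, ∀ z₃ ∈ S, ∀ z₄ ∈ S, z₁ ≠ u → z₂ ≠ u → z₃ ≠ u → z₄ ≠ u → dist u z₁ ≤ 1 + 1 / 4000 → dist u z₂ ≤ 1 + 1 / 4000 → dist u z₃ ≤ 1 + 1 / 4000 → dist u z₄ ≤ 1 + 1 / 4000 → dist z₁ z₂ ≤ 1 + 1 / 4000 → dist z₂ z₃ ≤ 1 + 1 / 4000 → dist z₃ z₄ ≤ 1 + 1 / 4000 → dist z₄ z₁ ≤ 1 + 1 / 4000 → ¬ dist z₁ z₃ ≤ 1 + 1 / 4000 → ¬ dist z₂ z₄ ≤ 1 + 1 / 4000 → ∃ w ∈ S, w ≠ u ∧ dist w z₁ ≤ 1 + 1 / 4000 ∧ dist w z₂ ≤ 1 + 1 / 4000 ∧ dist w z₃ ≤ 1 + 1 / 4000 ∧ dist w z₄ ≤ 1 + 1 / 4000) → (∀ (η : ℝ) (u w z₁ z₂ z₃ z₄ : EuclideanSpace ℝ (Fin 3)), 0 ≤ η → η ≤ 1 / 1000 → 1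 - η ≤ dist u z₁ → dist u z₁ ≤ 1 + η → 1 - η ≤ dist u z₂ → dist u z₂ ≤ 1 + η → 1 - η ≤ dist u z₃ → dist u z₃ ≤ 1 + η → 1 - η ≤ dist u z₄ → dist u z₄ ≤ 1 + η → 1 - η ≤ dist w z₁ → dist w z₁ ≤ 1 + η → 1 - η ≤ dist w z₂ → dist w z₂ ≤ 1 + η → 1 - η ≤ dist w z₃ → dist w z₃ ≤ 1 + η → 1 - η ≤ dist w z₄ → dist w z₄ ≤ 1 + η → 1 - η ≤ dist z₁ z₂ → dist z₁ z₂ ≤ 1 + η → 1 - η ≤ dist z₂ z₃ → dist z₂ z₃ ≤ 1 + η → 1 - η ≤ dist z₃ z₄ → dist z₃ z₄ ≤ 1 + η → 1 - η ≤ dist z₄ z₁ → dist z₄ z₁ ≤ 1 + η → 131 / 100 ≤ dist z₁ z₃ → 131 / 100 ≤ dist z₂ z₄ → 131 / 100 ≤ dist u w → |dist z₁ z₃ ^ 2 - 2| ≤ 38 * η ∧ |dist z₂ z₄ ^ 2 - 2| ≤ 38 * η ∧ |dist u w ^ 2 - 2| ≤ 29 * η) → (∀ (η : ℝ) (p c n₁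 n₂ n₃ n₄ : EuclideanSpace ℝ (Fin 3)), 0 ≤ η → η ≤ 1 / 1000 → 1 - η ≤ dist c p → dist c p ≤ 1 + η → 1 - η ≤ dist p n₁ → dist p n₁ ≤ 1 + η → 1 - η ≤ dist p n₂ → dist p n₂ ≤ 1 + η → 1 - η ≤ dist p n₃ → dist p n₃ ≤ 1 + η → 1 - η ≤ dist p n₄ → dist p n₄ ≤ 1 + η → 1 - η ≤ dist c n₁ → dist c n₁ ≤ 1 + η → 1 - η ≤ dist c n₂ → dist c n₂ ≤ 1 + η → 1 - η ≤ dist c n₃ → dist c n₃ ≤ 1 + η → 1 - η ≤ dist c n₄ → dist c n₄ ≤ 1 + η → 1 - η ≤ dist n₁ n₂ → dist n₁ n₂ ≤ 1 + η → 1 - η ≤ dist n₃ n₄ → dist n₃ n₄ ≤ 1 + η → |dist n₂ n₃ ^ 2 - 2| ≤ 38 * η → |dist n₄ n₁ ^ 2 - 2| ≤ 38 * η → 131 / 100 ≤ dist n₁ n₃ → 131 / 100 ≤ dist n₂ n₄ → |dist n₁ n₃ ^ 2 - 3| ≤ 40 * η ∧ |dist n₂ n₄ ^ 2 - 3| ≤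 40 * η) → (∀ (η : ℝ) (p c n₁ n₂ n₃ n₄ : EuclideanSpace ℝ (Fin 3)), 0 ≤ η → η ≤ 1 / 1000 → 1 - η ≤ dist c p → dist c p ≤ 1 + η → 1 - η ≤ dist p n₁ → dist p n₁ ≤ 1 + η → 1 - η ≤ dist p n₂ → dist p n₂ ≤ 1 + η → 1 - η ≤ dist p n₃ → dist p n₃ ≤ 1 + η → 1 - η ≤ dist p n₄ → dist p n₄ ≤ 1 + η → 1 - η ≤ dist c n₁ → dist c n₁ ≤ 1 + η → 1 - η ≤ dist c n₂ → dist c n₂ ≤ 1 + η → 1 - η ≤ dist c n₃ → dist c n₃ ≤ 1 + η → 1 - η ≤ dist c n₄ → dist c n₄ ≤ 1 + η → 1 - η ≤ dist n₁ n₂ → dist n₁ n₂ ≤ 1 + η → 1 - η ≤ dist n₂ n₃ → dist n₂ n₃ ≤ 1 + η → |dist n₃ n₄ ^ 2 - 2| ≤ 38 * η → |dist n₄ n₁ ^ 2 - 2| ≤ 38 * η → 131 / 100 ≤ dist n₁ n₃ → 131 / 100 ≤ dist n₂ n₄ → |dist n₁ n₃ ^ 2 - 8 / 3| ≤ 60 *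 η ∧ |dist n₂ n₄ ^ 2 - 3| ≤ 40 * η) → ((∀ t t' : {w : EuclideanSpace ℝ (Fin 3) // w ∈ S ∧ w ≠ u ∧ dist u w ≤ 1 + 1 / 400}, dist (e t).1 (e t').1 = Real.sqrt 2 → |dist t.1 t'.1 ^ 2 - 2| ≤ 38 / 4000) ∧ (∀ t t' : {w : EuclideanSpace ℝ (Fin 3) // w ∈ S ∧ w ≠ u ∧ dist u w ≤ 1 + 1 / 400}, dist (e t).1 (e t').1 = Real.sqrt 3 → |dist t.1 t'.1 ^ 2 - 3| ≤ 40 / 4000) ∧ (∀ t t' : {w : EuclideanSpace ℝ (Fin 3) // w ∈ S ∧ w ≠ u ∧ dist u w ≤ 1 + 1 / 400}, dist (e t).1 (e t').1 = Real.sqrt (8 / 3) → |dist t.1 t'.1 ^ 2 - 8 / 3| ≤ 60 / 4000))) (hCF : ∀ (u : EuclideanSpace ℝ (Fin 3)) (τ : {q : EuclideanSpace ℝ (Fin 3) // q ∈ Literature.Geometry.DiscreteGeometry.fccKissingPattern} → EuclideanSpace ℝ (Fin 3)), (∀ q : {q : EuclideanSpace ℝ (Fin 3) // q ∈ Literature.Geometry.DiscreteGeometry.fccKissingPattern},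 1 - 1 / 4000 ≤ dist u (τ q) ∧ dist u (τ q) ≤ 1 + 1 / 4000) → (∀ q q' : {q : EuclideanSpace ℝ (Fin 3) // q ∈ Literature.Geometry.DiscreteGeometry.fccKissingPattern}, dist q.1 q'.1 = 1 → 1 - 1 / 4000 ≤ dist (τ q) (τ q') ∧ dist (τ q) (τ q') ≤ 1 + 1 / 4000) → (∀ q q' : {q : EuclideanSpace ℝ (Fin 3) // q ∈ Literature.Geometry.DiscreteGeometry.fccKissingPattern}, dist q.1 q'.1 = Real.sqrt 2 → |dist (τ q) (τ q') ^ 2 - 2| ≤ 38 / 4000) → (∀ q q' : {q : EuclideanSpace ℝ (Fin 3) // q ∈ Literature.Geometry.DiscreteGeometry.fccKissingPattern}, dist q.1 q'.1 = Real.sqrt 3 → |dist (τ q) (τ q') ^ 2 - 3| ≤ 40 / 4000) → ∃ A : EuclideanSpace ℝ (Fin 3) →ₗᵢ[ℝ] EuclideanSpace ℝ (Fin 3), ∀ q : {q : EuclideanSpace ℝ (Fin 3) // q ∈ Literature.Geometry.DiscreteGeometry.fccKissingPattern}, ‖(τ q - u) - A q.1‖ ≤ 49 / 1000) (hCH : ∀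 (u : EuclideanSpace ℝ (Fin 3)) (τ : {q : EuclideanSpace ℝ (Fin 3) // q ∈ Literature.Geometry.DiscreteGeometry.hcpKissingPattern} → EuclideanSpace ℝ (Fin 3)), (∀ q : {q : EuclideanSpace ℝ (Fin 3) // q ∈ Literature.Geometry.DiscreteGeometry.hcpKissingPattern}, 1 - 1 / 4000 ≤ dist u (τ q) ∧ dist u (τ q) ≤ 1 + 1 / 4000) → (∀ q q' : {q : EuclideanSpace ℝ (Fin 3) // q ∈ Literature.Geometry.DiscreteGeometry.hcpKissingPattern}, dist q.1 q'.1 = 1 → 1 - 1 / 4000 ≤ dist (τ q) (τ q') ∧ dist (τ q) (τ q') ≤ 1 + 1 / 4000) → (∀ q q' : {q : EuclideanSpace ℝ (Fin 3) // q ∈ Literature.Geometry.DiscreteGeometry.hcpKissingPattern}, dist q.1 q'.1 = Real.sqrt 2 → |dist (τ q) (τ q') ^ 2 - 2| ≤ 38 / 4000) → (∀ q q' : {q : EuclideanSpace ℝ (Fin 3) // q ∈ Literature.Geometry.DiscreteGeometry.hcpKissingPattern}, dist q.1 q'.1 = Real.sqrt 3 → |dist (τ q) (τ q') ^ 2 -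 3| ≤ 40 / 4000) → (∀ q q' : {q : EuclideanSpace ℝ (Fin 3) // q ∈ Literature.Geometry.DiscreteGeometry.hcpKissingPattern}, dist q.1 q'.1 = Real.sqrt (8 / 3) → |dist (τ q) (τ q') ^ 2 - 8 / 3| ≤ 60 / 4000) → ∃ A : EuclideanSpace ℝ (Fin 3) →ₗᵢ[ℝ] EuclideanSpace ℝ (Fin 3), ∀ q : {q : EuclideanSpace ℝ (Fin 3) // q ∈ Literature.Geometry.DiscreteGeometry.hcpKissingPattern}, ‖(τ q - u) - A q.1‖ ≤ 49 / 1000) : ∀ (S : Set (EuclideanSpace ℝ (Fin 3))) (u : EuclideanSpace ℝ (Fin 3)), u ∈ S → (∀ v ∈ S, dist u v ≤ 13 / 5 → ((∀ w ∈ S, w ≠ v → 1 - 1 / 4000 ≤ dist v w ∧ (dist v w ≤ 1 + 1 / 4000 ∨ 131 / 100 ≤ dist v w)) ∧ {w ∈ S | w ≠ v ∧ dist v w ≤ 1 + 1 / 4000}.ncard = 12)) → ((∃ e : {w : EuclideanSpace ℝ (Fin 3) // w ∈ S ∧ w ≠ u ∧ dist u w ≤ 1 + 1 / 400} ≃ {q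 : EuclideanSpace ℝ (Fin 3) // q ∈ Literature.Geometry.DiscreteGeometry.fccKissingPattern}, ∀ w w' : {w : EuclideanSpace ℝ (Fin 3) // w ∈ S ∧ w ≠ u ∧ dist u w ≤ 1 + 1 / 400}, w ≠ w' → (dist w.1 w'.1 ≤ 1 + 1 / 400 ↔ dist (e w).1 (e w').1 = 1)) ∨ (∃ e : {w : EuclideanSpace ℝ (Fin 3) // w ∈ S ∧ w ≠ u ∧ dist u w ≤ 1 + 1 / 400} ≃ {q : EuclideanSpace ℝ (Fin 3) // q ∈ Literature.Geometry.DiscreteGeometry.hcpKissingPattern}, ∀ w w' : {w : EuclideanSpace ℝ (Fin 3) // w ∈ S ∧ w ≠ u ∧ dist u w ≤ 1 + 1 / 400}, w ≠ w' → (dist w.1 w'.1 ≤ 1 + 1 / 400 ↔ dist (e w).1 (e w').1 = 1))) → (∀ z₁ ∈ S, ∀ z₂ ∈ S, ∀ z₃ ∈ S, ∀ z₄ ∈ S, z₁ ≠ u → z₂ ≠ u → z₃ ≠ u → z₄ ≠ u → dist u z₁ ≤ 1 + 1 / 4000 → dist u z₂ ≤ 1 + 1 / 4000 → dist u z₃ ≤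 1 + 1 / 4000 → dist u z₄ ≤ 1 + 1 / 4000 → dist z₁ z₂ ≤ 1 + 1 / 4000 → dist z₂ z₃ ≤ 1 + 1 / 4000 → dist z₃ z₄ ≤ 1 + 1 / 4000 → dist z₄ z₁ ≤ 1 + 1 / 4000 → ¬ dist z₁ z₃ ≤ 1 + 1 / 4000 → ¬ dist z₂ z₄ ≤ 1 + 1 / 4000 → ∃ w ∈ S, w ≠ u ∧ dist w z₁ ≤ 1 + 1 / 4000 ∧ dist w z₂ ≤ 1 + 1 / 4000 ∧ dist w z₃ ≤ 1 + 1 / 4000 ∧ dist w z₄ ≤ 1 + 1 / 4000) → (∀ (η : ℝ) (u w z₁ z₂ z₃ z₄ : EuclideanSpace ℝ (Fin 3)), 0 ≤ η → η ≤ 1 / 1000 → 1 - η ≤ dist u z₁ → dist u z₁ ≤ 1 + η → 1 - η ≤ dist u z₂ → dist u z₂ ≤ 1 + η → 1 - η ≤ dist u z₃ → dist u z₃ ≤ 1 + η → 1 - η ≤ dist u z₄ → dist u z₄ ≤ 1 + η → 1 - η ≤ dist w z₁ → dist w z₁ ≤ 1 + η → 1 - η ≤ dist w z₂ → dist w z₂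 ≤ 1 + η → 1 - η ≤ dist w z₃ → dist w z₃ ≤ 1 + η → 1 - η ≤ dist w z₄ → dist w z₄ ≤ 1 + η → 1 - η ≤ dist z₁ z₂ → dist z₁ z₂ ≤ 1 + η → 1 - η ≤ dist z₂ z₃ → dist z₂ z₃ ≤ 1 + η → 1 - η ≤ dist z₃ z₄ → dist z₃ z₄ ≤ 1 + η → 1 - η ≤ dist z₄ z₁ → dist z₄ z₁ ≤ 1 + η → 131 / 100 ≤ dist z₁ z₃ → 131 / 100 ≤ dist z₂ z₄ → 131 / 100 ≤ dist u w → |dist z₁ z₃ - Real.sqrt 2| ≤ 30 * η ∧ |dist z₂ z₄ - Real.sqrt 2| ≤ 30 * η ∧ |dist u w - Real.sqrt 2| ≤ 30 * η) → Summit.AtomisticToContinuum.Crystallization.Theorems.SiteGood S u := by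
  intro S u hu hS hIso hCaps _hOct
  rcases hIso with ⟨e, he⟩ | ⟨e, he⟩
  · obtain ⟨hr2, hr3, -⟩ := hPins S u hu hS Literature.Geometry.DiscreteGeometry.fccKissingPattern
      (Or.inl rfl) e he hCaps oct_sq_bounds stub_linkQ.1 stub_linkQ.2
    obtain ⟨A, hA⟩ := hCF u (fun q => (e.symm q).1) (fun q => red_norm_band hu hS e q)
      (fun q q' h => red_contact_band hS e he q q' h)
      (fun q q' h => by simpa using hr2 (e.symm q) (e.symm q') (by simpa using h))
      (fun q q' h => by simpa using hr3 (e.symm q) (e.symm q') (by simpa using h))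
    exact siteGood_of_frameApprox hu hS (Or.inl rfl) e A fun t => by simpa using hA (e t)
  · obtain ⟨hr2, hr3, hr83⟩ := hPins S u hu hS Literature.Geometry.DiscreteGeometry.hcpKissingPattern
      (Or.inr rfl) e he hCaps oct_sq_bounds stub_linkQ.1 stub_linkQ.2
    obtain ⟨A, hA⟩ := hCH u (fun q => (e.symm q).1) (fun q => red_norm_band hu hS e q)
      (fun q q' h => red_contact_band hS e he q q' h)
      (fun q q' h => by simpa using hr2 (e.symm q) (e.symm q') (by simpa using h))
      (fun q q' h => by simpa using hr3 (e.symm q) (e.symm q') (by simpa using h))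
      (fun q q' h => by simpa using hr83 (e.symm q) (e.symm q') (by simpa using h))
    exact siteGood_of_frameApprox hu hS (Or.inr rfl) e A fun t => by simpa using hA (e t)

/-- POINTWISE, SCALE `1`: two-shell `1/4000`-soft kissing about `u ∈ S` forces `SiteGood S u`, given local Hales
(`hLHK`) at `u` and its twelve neighbours. [folklore] -/
theorem red_siteGood_of_twoShellSoftKissed (hLHK : ∀ (S : Set (EuclideanSpace ℝ (Fin 3))) (u : EuclideanSpace ℝ (Fin 3)), u ∈ S → (∀ v ∈ S, dist u v ≤ 1 + 1 / 400 → ((∀ w ∈ S, w ≠ v → 1 - 1 / 400 ≤ dist v w ∧ (dist v w ≤ 1 + 1 / 400 ∨ 63 / 50 ≤ dist v w)) ∧ {w ∈ S | w ≠ v ∧ dist v w ≤ 1 + 1 / 400}.ncard = 12)) → ((∃ e : {w : EuclideanSpace ℝ (Fin 3) // w ∈ S ∧ w ≠ u ∧ dist u w ≤ 1 + 1 / 400} ≃ {q : EuclideanSpace ℝ (Fin 3) // q ∈ Literature.Geometry.DiscreteGeometry.fccKissingPattern}, ∀ w w' : {w : EuclideanSpace ℝ (Fin 3) // w ∈ S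 ∧ w ≠ u ∧ dist u w ≤ 1 + 1 / 400}, w ≠ w' → (dist w.1 w'.1 ≤ 1 + 1 / 400 ↔ dist (e w).1 (e w').1 = 1)) ∨ (∃ e : {w : EuclideanSpace ℝ (Fin 3) // w ∈ S ∧ w ≠ u ∧ dist u w ≤ 1 + 1 / 400} ≃ {q : EuclideanSpace ℝ (Fin 3) // q ∈ Literature.Geometry.DiscreteGeometry.hcpKissingPattern}, ∀ w w' : {w : EuclideanSpace ℝ (Fin 3) // w ∈ S ∧ w ≠ u ∧ dist u w ≤ 1 + 1 / 400}, w ≠ w' → (dist w.1 w'.1 ≤ 1 + 1 / 400 ↔ dist (e w).1 (e w').1 = 1)))) (hPins : ∀ (S : Set (EuclideanSpace ℝ (Fin 3))) (u : EuclideanSpace ℝ (Fin 3)), u ∈ S → (∀ v ∈ S, dist u v ≤ 13 / 5 → ((∀ w ∈ S, w ≠ v → 1 - 1 / 4000 ≤ dist v w ∧ (dist v w ≤ 1 + 1 / 4000 ∨ 131 / 100 ≤ dist v w)) ∧ {w ∈ S | w ≠ v ∧ dist v w ≤ 1 + 1 / 4000}.ncard = 12)) → ∀ (P : Finset (EuclideanSpace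 ℝ (Fin 3))), (P = Literature.Geometry.DiscreteGeometry.fccKissingPattern ∨ P = Literature.Geometry.DiscreteGeometry.hcpKissingPattern) → ∀ (e : {w : EuclideanSpace ℝ (Fin 3) // w ∈ S ∧ w ≠ u ∧ dist u w ≤ 1 + 1 / 400} ≃ {q : EuclideanSpace ℝ (Fin 3) // q ∈ P}), (∀ w w' : {w : EuclideanSpace ℝ (Fin 3) // w ∈ S ∧ w ≠ u ∧ dist u w ≤ 1 + 1 / 400}, w ≠ w' → (dist w.1 w'.1 ≤ 1 + 1 / 400 ↔ dist (e w).1 (e w').1 = 1)) → (∀ z₁ ∈ S, ∀ z₂ ∈ S, ∀ z₃ ∈ S, ∀ z₄ ∈ S, z₁ ≠ u → z₂ ≠ u → z₃ ≠ u → z₄ ≠ u → dist u z₁ ≤ 1 + 1 / 4000 → dist u z₂ ≤ 1 + 1 / 4000 → dist u z₃ ≤ 1 + 1 / 4000 → dist u z₄ ≤ 1 + 1 / 4000 → dist z₁ z₂ ≤ 1 + 1 / 4000 → dist z₂ z₃ ≤ 1 + 1 / 4000 → dist z₃ z₄ ≤ 1 + 1 / 4000 → dist z₄ z₁ ≤ 1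 + 1 / 4000 → ¬ dist z₁ z₃ ≤ 1 + 1 / 4000 → ¬ dist z₂ z₄ ≤ 1 + 1 / 4000 → ∃ w ∈ S, w ≠ u ∧ dist w z₁ ≤ 1 + 1 / 4000 ∧ dist w z₂ ≤ 1 + 1 / 4000 ∧ dist w z₃ ≤ 1 + 1 / 4000 ∧ dist w z₄ ≤ 1 + 1 / 4000) → (∀ (η : ℝ) (u w z₁ z₂ z₃ z₄ : EuclideanSpace ℝ (Fin 3)), 0 ≤ η → η ≤ 1 / 1000 → 1 - η ≤ dist u z₁ → dist u z₁ ≤ 1 + η → 1 - η ≤ dist u z₂ → dist u z₂ ≤ 1 + η → 1 - η ≤ dist u z₃ → dist u z₃ ≤ 1 + η → 1 - η ≤ dist u z₄ → dist u z₄ ≤ 1 + η → 1 - η ≤ dist w z₁ → dist w z₁ ≤ 1 + η → 1 - η ≤ dist w z₂ → dist w z₂ ≤ 1 + η → 1 - η ≤ dist w z₃ → dist w z₃ ≤ 1 + η → 1 - η ≤ dist w z₄ → dist w z₄ ≤ 1 + η → 1 - η ≤ dist z₁ z₂ → dist z₁ z₂ ≤ 1 + η → 1 - η ≤ dist z₂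 z₃ → dist z₂ z₃ ≤ 1 + η → 1 - η ≤ dist z₃ z₄ → dist z₃ z₄ ≤ 1 + η → 1 - η ≤ dist z₄ z₁ → dist z₄ z₁ ≤ 1 + η → 131 / 100 ≤ dist z₁ z₃ → 131 / 100 ≤ dist z₂ z₄ → 131 / 100 ≤ dist u w → |dist z₁ z₃ ^ 2 - 2| ≤ 38 * η ∧ |dist z₂ z₄ ^ 2 - 2| ≤ 38 * η ∧ |dist u w ^ 2 - 2| ≤ 29 * η) → (∀ (η : ℝ) (p c n₁ n₂ n₃ n₄ : EuclideanSpace ℝ (Fin 3)), 0 ≤ η → η ≤ 1 / 1000 → 1 - η ≤ dist c p → dist c p ≤ 1 + η → 1 - η ≤ dist p n₁ → dist p n₁ ≤ 1 + η → 1 - η ≤ dist p n₂ → dist p n₂ ≤ 1 + η → 1 - η ≤ dist p n₃ → dist p n₃ ≤ 1 + η → 1 - η ≤ dist p n₄ → dist p n₄ ≤ 1 + η → 1 - η ≤ dist c n₁ → dist c n₁ ≤ 1 + η → 1 - η ≤ dist c n₂ → dist c n₂ ≤ 1 + η → 1 - η ≤ dist c n₃ → dist c n₃ ≤ 1 + η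 → 1 - η ≤ dist c n₄ → dist c n₄ ≤ 1 + η → 1 - η ≤ dist n₁ n₂ → dist n₁ n₂ ≤ 1 + η → 1 - η ≤ dist n₃ n₄ → dist n₃ n₄ ≤ 1 + η → |dist n₂ n₃ ^ 2 - 2| ≤ 38 * η → |dist n₄ n₁ ^ 2 - 2| ≤ 38 * η → 131 / 100 ≤ dist n₁ n₃ → 131 / 100 ≤ dist n₂ n₄ → |dist n₁ n₃ ^ 2 - 3| ≤ 40 * η ∧ |dist n₂ n₄ ^ 2 - 3| ≤ 40 * η) → (∀ (η : ℝ) (p c n₁ n₂ n₃ n₄ : EuclideanSpace ℝ (Fin 3)), 0 ≤ η → η ≤ 1 / 1000 → 1 - η ≤ dist c p → dist c p ≤ 1 + η → 1 - η ≤ dist p n₁ → dist p n₁ ≤ 1 + η → 1 - η ≤ dist p n₂ → dist p n₂ ≤ 1 + η → 1 - η ≤ dist p n₃ → dist p n₃ ≤ 1 + η → 1 - η ≤ dist p n₄ → dist p n₄ ≤ 1 + η → 1 - η ≤ dist c n₁ → dist c n₁ ≤ 1 + η → 1 - η ≤ dist c n₂ → dist c n₂ ≤ 1 + η → 1 - η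 ≤ dist c n₃ → dist c n₃ ≤ 1 + η → 1 - η ≤ dist c n₄ → dist c n₄ ≤ 1 + η → 1 - η ≤ dist n₁ n₂ → dist n₁ n₂ ≤ 1 + η → 1 - η ≤ dist n₂ n₃ → dist n₂ n₃ ≤ 1 + η → |dist n₃ n₄ ^ 2 - 2| ≤ 38 * η → |dist n₄ n₁ ^ 2 - 2| ≤ 38 * η → 131 / 100 ≤ dist n₁ n₃ → 131 / 100 ≤ dist n₂ n₄ → |dist n₁ n₃ ^ 2 - 8 / 3| ≤ 60 * η ∧ |dist n₂ n₄ ^ 2 - 3| ≤ 40 * η) → ((∀ t t' : {w : EuclideanSpace ℝ (Fin 3) // w ∈ S ∧ w ≠ u ∧ dist u w ≤ 1 + 1 / 400}, dist (e t).1 (e t').1 = Real.sqrt 2 → |dist t.1 t'.1 ^ 2 - 2| ≤ 38 / 4000) ∧ (∀ t t' : {w : EuclideanSpace ℝ (Fin 3) // w ∈ S ∧ w ≠ u ∧ dist u w ≤ 1 + 1 / 400}, dist (e t).1 (e t').1 = Real.sqrt 3 → |dist t.1 t'.1 ^ 2 - 3| ≤ 40 / 4000) ∧ (∀ t t' : {w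 : EuclideanSpace ℝ (Fin 3) // w ∈ S ∧ w ≠ u ∧ dist u w ≤ 1 + 1 / 400}, dist (e t).1 (e t').1 = Real.sqrt (8 / 3) → |dist t.1 t'.1 ^ 2 - 8 / 3| ≤ 60 / 4000))) (hCF : ∀ (u : EuclideanSpace ℝ (Fin 3)) (τ : {q : EuclideanSpace ℝ (Fin 3) // q ∈ Literature.Geometry.DiscreteGeometry.fccKissingPattern} → EuclideanSpace ℝ (Fin 3)), (∀ q : {q : EuclideanSpace ℝ (Fin 3) // q ∈ Literature.Geometry.DiscreteGeometry.fccKissingPattern}, 1 - 1 / 4000 ≤ dist u (τ q) ∧ dist u (τ q) ≤ 1 + 1 / 4000) → (∀ q q' : {q : EuclideanSpace ℝ (Fin 3) // q ∈ Literature.Geometry.DiscreteGeometry.fccKissingPattern}, dist q.1 q'.1 = 1 → 1 - 1 / 4000 ≤ dist (τ q) (τ q') ∧ dist (τ q) (τ q') ≤ 1 + 1 / 4000) → (∀ q q' : {q : EuclideanSpace ℝ (Fin 3) // q ∈ Literature.Geometry.DiscreteGeometry.fccKissingPattern}, dist q.1 q'.1 = Real.sqrt 2 → |dist (τ q) (τ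 q') ^ 2 - 2| ≤ 38 / 4000) → (∀ q q' : {q : EuclideanSpace ℝ (Fin 3) // q ∈ Literature.Geometry.DiscreteGeometry.fccKissingPattern}, dist q.1 q'.1 = Real.sqrt 3 → |dist (τ q) (τ q') ^ 2 - 3| ≤ 40 / 4000) → ∃ A : EuclideanSpace ℝ (Fin 3) →ₗᵢ[ℝ] EuclideanSpace ℝ (Fin 3), ∀ q : {q : EuclideanSpace ℝ (Fin 3) // q ∈ Literature.Geometry.DiscreteGeometry.fccKissingPattern}, ‖(τ q - u) - A q.1‖ ≤ 49 / 1000) (hCH : ∀ (u : EuclideanSpace ℝ (Fin 3)) (τ : {q : EuclideanSpace ℝ (Fin 3) // q ∈ Literature.Geometry.DiscreteGeometry.hcpKissingPattern} → EuclideanSpace ℝ (Fin 3)), (∀ q : {q : EuclideanSpace ℝ (Fin 3) // q ∈ Literature.Geometry.DiscreteGeometry.hcpKissingPattern}, 1 - 1 / 4000 ≤ dist u (τ q) ∧ dist u (τ q) ≤ 1 + 1 / 4000) → (∀ q q' : {q : EuclideanSpace ℝ (Fin 3) // q ∈ Literature.Geometry.DiscreteGeometry.hcpKissingPattern}, dist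 q.1 q'.1 = 1 → 1 - 1 / 4000 ≤ dist (τ q) (τ q') ∧ dist (τ q) (τ q') ≤ 1 + 1 / 4000) → (∀ q q' : {q : EuclideanSpace ℝ (Fin 3) // q ∈ Literature.Geometry.DiscreteGeometry.hcpKissingPattern}, dist q.1 q'.1 = Real.sqrt 2 → |dist (τ q) (τ q') ^ 2 - 2| ≤ 38 / 4000) → (∀ q q' : {q : EuclideanSpace ℝ (Fin 3) // q ∈ Literature.Geometry.DiscreteGeometry.hcpKissingPattern}, dist q.1 q'.1 = Real.sqrt 3 → |dist (τ q) (τ q') ^ 2 - 3| ≤ 40 / 4000) → (∀ q q' : {q : EuclideanSpace ℝ (Fin 3) // q ∈ Literature.Geometry.DiscreteGeometry.hcpKissingPattern}, dist q.1 q'.1 = Real.sqrt (8 / 3) → |dist (τ q) (τ q') ^ 2 - 8 / 3| ≤ 60 / 4000) → ∃ A : EuclideanSpace ℝ (Fin 3) →ₗᵢ[ℝ] EuclideanSpace ℝ (Fin 3), ∀ q : {q : EuclideanSpace ℝ (Fin 3) // q ∈ Literature.Geometry.DiscreteGeometry.hcpKissingPattern}, ‖(τ q - u) - A q.1‖ ≤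 49 / 1000) (S : Set (EuclideanSpace ℝ (Fin 3)))
    (u : EuclideanSpace ℝ (Fin 3)) (hu : u ∈ S) (hS : (∀ v ∈ S, dist u v ≤ 13 / 5 → ((∀ w ∈ S, w ≠ v → 1 - 1 / 4000 ≤ dist v w ∧ (dist v w ≤ 1 + 1 / 4000 ∨ 131 / 100 ≤ dist v w)) ∧ {w ∈ S | w ≠ v ∧ dist v w ≤ 1 + 1 / 4000}.ncard = 12))) :
    Summit.AtomisticToContinuum.Crystallization.Theorems.SiteGood S u := by
  have hIso_u := hLHK S u hu (red_lhk_hypotheses S u hS u (Or.inl rfl))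
  have hIso_z : ∀ z ∈ S, z ≠ u → dist u z ≤ 1 + 1 / 4000 → ((∃ e : {w : EuclideanSpace ℝ (Fin 3) // w ∈ S ∧ w ≠ z ∧ dist z w ≤ 1 + 1 / 400} ≃ {q : EuclideanSpace ℝ (Fin 3) // q ∈ Literature.Geometry.DiscreteGeometry.fccKissingPattern}, ∀ w w' : {w : EuclideanSpace ℝ (Fin 3) // w ∈ S ∧ w ≠ z ∧ dist z w ≤ 1 + 1 / 400}, w ≠ w' → (dist w.1 w'.1 ≤ 1 + 1 / 400 ↔ dist (e w).1 (e w').1 = 1)) ∨ (∃ e : {w : EuclideanSpace ℝ (Fin 3) // w ∈ S ∧ w ≠ z ∧ dist z w ≤ 1 + 1 / 400} ≃ {q : EuclideanSpace ℝ (Fin 3) // q ∈ Literature.Geometry.DiscreteGeometry.hcpKissingPattern}, ∀ w w' : {w : EuclideanSpace ℝ (Fin 3) // w ∈ S ∧ w ≠ z ∧ dist z w ≤ 1 + 1 / 400}, w ≠ w' → (dist w.1 w'.1 ≤ 1 + 1 / 400 ↔ dist (e w).1 (e w').1 = 1))) :=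
    fun z hz _ hdz => hLHK S z hz (red_lhk_hypotheses S u hS z (Or.inr ⟨hz, hdz⟩))
  have hcaps := stub_capAtoms S u hu hS hIso_u hIso_z stub_linkLemma.1 stub_linkLemma.2
  exact red_assembly hPins hCF hCH S u hu hS hIso_u hcaps stub_octahedron

/-- POINTWISE, ANY SCALE: a `1/4000`-soft-kissed `13/5·a`-neighbourhood forces a good shell. [folklore] -/
theorem red_siteGood_of_softKissedNbhd (hLHK : ∀ (S : Set (EuclideanSpace ℝ (Fin 3))) (u : EuclideanSpace ℝ (Fin 3)), u ∈ S → (∀ v ∈ S, dist u v ≤ 1 + 1 / 400 → ((∀ w ∈ S, w ≠ v → 1 - 1 / 400 ≤ dist v w ∧ (dist v w ≤ 1 + 1 / 400 ∨ 63 / 50 ≤ dist v w)) ∧ {w ∈ S | w ≠ v ∧ dist v w ≤ 1 + 1 / 400}.ncard = 12)) → ((∃ e : {w : EuclideanSpace ℝ (Fin 3) // w ∈ S ∧ w ≠ u ∧ dist u w ≤ 1 + 1 / 400} ≃ {q : EuclideanSpace ℝ (Fin 3) // q ∈ Literature.Geometry.DiscreteGeometry.fccKissingPattern}, ∀ w w'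 : {w : EuclideanSpace ℝ (Fin 3) // w ∈ S ∧ w ≠ u ∧ dist u w ≤ 1 + 1 / 400}, w ≠ w' → (dist w.1 w'.1 ≤ 1 + 1 / 400 ↔ dist (e w).1 (e w').1 = 1)) ∨ (∃ e : {w : EuclideanSpace ℝ (Fin 3) // w ∈ S ∧ w ≠ u ∧ dist u w ≤ 1 + 1 / 400} ≃ {q : EuclideanSpace ℝ (Fin 3) // q ∈ Literature.Geometry.DiscreteGeometry.hcpKissingPattern}, ∀ w w' : {w : EuclideanSpace ℝ (Fin 3) // w ∈ S ∧ w ≠ u ∧ dist u w ≤ 1 + 1 / 400}, w ≠ w' → (dist w.1 w'.1 ≤ 1 + 1 / 400 ↔ dist (e w).1 (e w').1 = 1)))) (hPins : ∀ (S : Set (EuclideanSpace ℝ (Fin 3))) (u : EuclideanSpace ℝ (Fin 3)), u ∈ S → (∀ v ∈ S, dist u v ≤ 13 / 5 → ((∀ w ∈ S, w ≠ v → 1 - 1 / 4000 ≤ dist v w ∧ (dist v w ≤ 1 + 1 / 4000 ∨ 131 / 100 ≤ dist v w)) ∧ {w ∈ S | w ≠ v ∧ dist v w ≤ 1 + 1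 / 4000}.ncard = 12)) → ∀ (P : Finset (EuclideanSpace ℝ (Fin 3))), (P = Literature.Geometry.DiscreteGeometry.fccKissingPattern ∨ P = Literature.Geometry.DiscreteGeometry.hcpKissingPattern) → ∀ (e : {w : EuclideanSpace ℝ (Fin 3) // w ∈ S ∧ w ≠ u ∧ dist u w ≤ 1 + 1 / 400} ≃ {q : EuclideanSpace ℝ (Fin 3) // q ∈ P}), (∀ w w' : {w : EuclideanSpace ℝ (Fin 3) // w ∈ S ∧ w ≠ u ∧ dist u w ≤ 1 + 1 / 400}, w ≠ w' → (dist w.1 w'.1 ≤ 1 + 1 / 400 ↔ dist (e w).1 (e w').1 = 1)) → (∀ z₁ ∈ S, ∀ z₂ ∈ S, ∀ z₃ ∈ S, ∀ z₄ ∈ S, z₁ ≠ u → z₂ ≠ u → z₃ ≠ u → z₄ ≠ u → dist u z₁ ≤ 1 + 1 / 4000 → dist u z₂ ≤ 1 + 1 / 4000 → dist u z₃ ≤ 1 + 1 / 4000 → dist u z₄ ≤ 1 + 1 / 4000 → dist z₁ z₂ ≤ 1 + 1 / 4000 → dist z₂ z₃ ≤ 1 + 1 / 4000 → dist z₃ z₄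 ≤ 1 + 1 / 4000 → dist z₄ z₁ ≤ 1 + 1 / 4000 → ¬ dist z₁ z₃ ≤ 1 + 1 / 4000 → ¬ dist z₂ z₄ ≤ 1 + 1 / 4000 → ∃ w ∈ S, w ≠ u ∧ dist w z₁ ≤ 1 + 1 / 4000 ∧ dist w z₂ ≤ 1 + 1 / 4000 ∧ dist w z₃ ≤ 1 + 1 / 4000 ∧ dist w z₄ ≤ 1 + 1 / 4000) → (∀ (η : ℝ) (u w z₁ z₂ z₃ z₄ : EuclideanSpace ℝ (Fin 3)), 0 ≤ η → η ≤ 1 / 1000 → 1 - η ≤ dist u z₁ → dist u z₁ ≤ 1 + η → 1 - η ≤ dist u z₂ → dist u z₂ ≤ 1 + η → 1 - η ≤ dist u z₃ → dist u z₃ ≤ 1 + η → 1 - η ≤ dist u z₄ → dist u z₄ ≤ 1 + η → 1 - η ≤ dist w z₁ → dist w z₁ ≤ 1 + η → 1 - η ≤ dist w z₂ → dist w z₂ ≤ 1 + η → 1 - η ≤ dist w z₃ → dist w z₃ ≤ 1 + η → 1 - η ≤ dist w z₄ → dist w z₄ ≤ 1 + η → 1 - η ≤ dist z₁ z₂ →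 dist z₁ z₂ ≤ 1 + η → 1 - η ≤ dist z₂ z₃ → dist z₂ z₃ ≤ 1 + η → 1 - η ≤ dist z₃ z₄ → dist z₃ z₄ ≤ 1 + η → 1 - η ≤ dist z₄ z₁ → dist z₄ z₁ ≤ 1 + η → 131 / 100 ≤ dist z₁ z₃ → 131 / 100 ≤ dist z₂ z₄ → 131 / 100 ≤ dist u w → |dist z₁ z₃ ^ 2 - 2| ≤ 38 * η ∧ |dist z₂ z₄ ^ 2 - 2| ≤ 38 * η ∧ |dist u w ^ 2 - 2| ≤ 29 * η) → (∀ (η : ℝ) (p c n₁ n₂ n₃ n₄ : EuclideanSpace ℝ (Fin 3)), 0 ≤ η → η ≤ 1 / 1000 → 1 - η ≤ dist c p → dist c p ≤ 1 + η → 1 - η ≤ dist p n₁ → dist p n₁ ≤ 1 + η → 1 - η ≤ dist p n₂ → dist p n₂ ≤ 1 + η → 1 - η ≤ dist p n₃ → dist p n₃ ≤ 1 + η → 1 - η ≤ dist p n₄ → dist p n₄ ≤ 1 + η → 1 - η ≤ dist c n₁ → dist c n₁ ≤ 1 + η → 1 - η ≤ dist c n₂ → dist c n₂ ≤ 1 +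 η → 1 - η ≤ dist c n₃ → dist c n₃ ≤ 1 + η → 1 - η ≤ dist c n₄ → dist c n₄ ≤ 1 + η → 1 - η ≤ dist n₁ n₂ → dist n₁ n₂ ≤ 1 + η → 1 - η ≤ dist n₃ n₄ → dist n₃ n₄ ≤ 1 + η → |dist n₂ n₃ ^ 2 - 2| ≤ 38 * η → |dist n₄ n₁ ^ 2 - 2| ≤ 38 * η → 131 / 100 ≤ dist n₁ n₃ → 131 / 100 ≤ dist n₂ n₄ → |dist n₁ n₃ ^ 2 - 3| ≤ 40 * η ∧ |dist n₂ n₄ ^ 2 - 3| ≤ 40 * η) → (∀ (η : ℝ) (p c n₁ n₂ n₃ n₄ : EuclideanSpace ℝ (Fin 3)), 0 ≤ η → η ≤ 1 / 1000 → 1 - η ≤ dist c p → dist c p ≤ 1 + η → 1 - η ≤ dist p n₁ → dist p n₁ ≤ 1 + η → 1 - η ≤ dist p n₂ → dist p n₂ ≤ 1 + η → 1 - η ≤ dist p n₃ → dist p n₃ ≤ 1 + η → 1 - η ≤ dist p n₄ → dist p n₄ ≤ 1 + η → 1 - η ≤ dist c n₁ → dist c n₁ ≤ 1 + η → 1 -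 η ≤ dist c n₂ → dist c n₂ ≤ 1 + η → 1 - η ≤ dist c n₃ → dist c n₃ ≤ 1 + η → 1 - η ≤ dist c n₄ → dist c n₄ ≤ 1 + η → 1 - η ≤ dist n₁ n₂ → dist n₁ n₂ ≤ 1 + η → 1 - η ≤ dist n₂ n₃ → dist n₂ n₃ ≤ 1 + η → |dist n₃ n₄ ^ 2 - 2| ≤ 38 * η → |dist n₄ n₁ ^ 2 - 2| ≤ 38 * η → 131 / 100 ≤ dist n₁ n₃ → 131 / 100 ≤ dist n₂ n₄ → |dist n₁ n₃ ^ 2 - 8 / 3| ≤ 60 * η ∧ |dist n₂ n₄ ^ 2 - 3| ≤ 40 * η) → ((∀ t t' : {w : EuclideanSpace ℝ (Fin 3) // w ∈ S ∧ w ≠ u ∧ dist u w ≤ 1 + 1 / 400}, dist (e t).1 (e t').1 = Real.sqrt 2 → |dist t.1 t'.1 ^ 2 - 2| ≤ 38 / 4000) ∧ (∀ t t' : {w : EuclideanSpace ℝ (Fin 3) // w ∈ S ∧ w ≠ u ∧ dist u w ≤ 1 + 1 / 400}, dist (e t).1 (e t').1 = Real.sqrt 3 → |dist t.1 t'.1 ^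 2 - 3| ≤ 40 / 4000) ∧ (∀ t t' : {w : EuclideanSpace ℝ (Fin 3) // w ∈ S ∧ w ≠ u ∧ dist u w ≤ 1 + 1 / 400}, dist (e t).1 (e t').1 = Real.sqrt (8 / 3) → |dist t.1 t'.1 ^ 2 - 8 / 3| ≤ 60 / 4000))) (hCF : ∀ (u : EuclideanSpace ℝ (Fin 3)) (τ : {q : EuclideanSpace ℝ (Fin 3) // q ∈ Literature.Geometry.DiscreteGeometry.fccKissingPattern} → EuclideanSpace ℝ (Fin 3)), (∀ q : {q : EuclideanSpace ℝ (Fin 3) // q ∈ Literature.Geometry.DiscreteGeometry.fccKissingPattern}, 1 - 1 / 4000 ≤ dist u (τ q) ∧ dist u (τ q) ≤ 1 + 1 / 4000) → (∀ q q' : {q : EuclideanSpace ℝ (Fin 3) // q ∈ Literature.Geometry.DiscreteGeometry.fccKissingPattern}, dist q.1 q'.1 = 1 → 1 - 1 / 4000 ≤ dist (τ q) (τ q') ∧ dist (τ q) (τ q') ≤ 1 + 1 / 4000) → (∀ q q' : {q : EuclideanSpace ℝ (Fin 3) // q ∈ Literature.Geometry.DiscreteGeometry.fccKissingPattern}, dist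 q.1 q'.1 = Real.sqrt 2 → |dist (τ q) (τ q') ^ 2 - 2| ≤ 38 / 4000) → (∀ q q' : {q : EuclideanSpace ℝ (Fin 3) // q ∈ Literature.Geometry.DiscreteGeometry.fccKissingPattern}, dist q.1 q'.1 = Real.sqrt 3 → |dist (τ q) (τ q') ^ 2 - 3| ≤ 40 / 4000) → ∃ A : EuclideanSpace ℝ (Fin 3) →ₗᵢ[ℝ] EuclideanSpace ℝ (Fin 3), ∀ q : {q : EuclideanSpace ℝ (Fin 3) // q ∈ Literature.Geometry.DiscreteGeometry.fccKissingPattern}, ‖(τ q - u) - A q.1‖ ≤ 49 / 1000) (hCH : ∀ (u : EuclideanSpace ℝ (Fin 3)) (τ : {q : EuclideanSpace ℝ (Fin 3) // q ∈ Literature.Geometry.DiscreteGeometry.hcpKissingPattern} → EuclideanSpace ℝ (Fin 3)), (∀ q : {q : EuclideanSpace ℝ (Fin 3) // q ∈ Literature.Geometry.DiscreteGeometry.hcpKissingPattern}, 1 - 1 / 4000 ≤ dist u (τ q) ∧ dist u (τ q) ≤ 1 + 1 / 4000) → (∀ q q' : {q : EuclideanSpace ℝ (Fin 3) // q ∈ Literature.Geometry.DiscreteGeometry.hcpKissingPattern},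 dist q.1 q'.1 = 1 → 1 - 1 / 4000 ≤ dist (τ q) (τ q') ∧ dist (τ q) (τ q') ≤ 1 + 1 / 4000) → (∀ q q' : {q : EuclideanSpace ℝ (Fin 3) // q ∈ Literature.Geometry.DiscreteGeometry.hcpKissingPattern}, dist q.1 q'.1 = Real.sqrt 2 → |dist (τ q) (τ q') ^ 2 - 2| ≤ 38 / 4000) → (∀ q q' : {q : EuclideanSpace ℝ (Fin 3) // q ∈ Literature.Geometry.DiscreteGeometry.hcpKissingPattern}, dist q.1 q'.1 = Real.sqrt 3 → |dist (τ q) (τ q') ^ 2 - 3| ≤ 40 / 4000) → (∀ q q' : {q : EuclideanSpace ℝ (Fin 3) // q ∈ Literature.Geometry.DiscreteGeometry.hcpKissingPattern}, dist q.1 q'.1 = Real.sqrt (8 / 3) → |dist (τ q) (τ q') ^ 2 - 8 / 3| ≤ 60 / 4000) → ∃ A : EuclideanSpace ℝ (Fin 3) →ₗᵢ[ℝ] EuclideanSpace ℝ (Fin 3), ∀ q : {q : EuclideanSpace ℝ (Fin 3) // q ∈ Literature.Geometry.DiscreteGeometry.hcpKissingPattern}, ‖(τ q - u) - A q.1‖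 ≤ 49 / 1000) (S : Set (EuclideanSpace ℝ (Fin 3)))
    (u : EuclideanSpace ℝ (Fin 3)) (hu : u ∈ S)
    (h : ∃ a : ℝ, 0 < a ∧ ∀ v ∈ S, dist u v ≤ 13 / 5 * a → ((∀ w ∈ S, w ≠ v → (1 - 1 / 4000) * a ≤ dist v w ∧ (dist v w ≤ (1 + 1 / 4000) * a ∨ 131 / 100 * a ≤ dist v w)) ∧ {w ∈ S | w ≠ v ∧ dist v w ≤ (1 + 1 / 4000) * a}.ncard = 12)) :
    Summit.AtomisticToContinuum.Crystallization.Theorems.SiteGood S u := by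
  obtain ⟨a, ha, hSK⟩ := h
  refine stub_scaling.1 S u a ha ?_
  refine red_siteGood_of_twoShellSoftKissed hLHK hPins hCF hCH _ _ ⟨u, hu, rfl⟩ ?_
  rintro v' ⟨v, hv, rfl⟩ hd
  have hainv : 0 < a⁻¹ := inv_pos.mpr ha
  have hd' : dist u v ≤ 13 / 5 * a := by
    have h1 : dist (a⁻¹ • u) (a⁻¹ • v) = a⁻¹ * dist u v := by
      rw [dist_smul₀, Real.norm_of_nonneg hainv.le]
    rw [h1] at hd
    have := (inv_mul_le_iff₀ ha).mp hd
    linarith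
  exact stub_scaling.2 S v a ha (hSK v hv hd')

/-- **THE REDUCTION** (registered sub-goal `zeroDefectDensity_reduction`): soft kissing order a.e. (`hSKO`) and effective local
Hales at tolerance `1/400` (`hLHK` = `BrittleRungDescent.LocalHalesKernel`, stmt-9208) — together with the line's open provable stubs pins, coordsFcc, coordsHcp — imply the crux
`HullExactificationCascade.ZeroDefectDensity`. [folklore] -/
theorem zeroDefectDensity_reduction : (∀ (x : (N : ℕ) → (Fin N → EuclideanSpace ℝ (Fin 3))), (∀ N, Literature.MathematicalPhysics.StatisticalMechanics.IsGroundState Literature.MathematicalPhysics.StatisticalMechanics.lennardJones (x N)) → Filter.Tendsto (fun N : ℕ => (Nat.card {i : Fin N // ¬ (∃ a : ℝ, 0 < a ∧ ∀ v ∈ Set.range (x N), dist (x N i) v ≤ 13 / 5 * a → ((∀ w ∈ Set.range (x N), w ≠ v → (1 - 1 / 4000) * a ≤ dist v w ∧ (dist v w ≤ (1 + 1 / 4000) * a ∨ 131 / 100 * a ≤ dist v w)) ∧ {w ∈ Set.range (x N) | w ≠ v ∧ dist v w ≤ (1 + 1 / 4000) * a}.ncard = 12))} : ℝ) / (N : ℝ))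 Filter.atTop (nhds (0 : ℝ))) → (∀ (S : Set (EuclideanSpace ℝ (Fin 3))) (u : EuclideanSpace ℝ (Fin 3)), u ∈ S → (∀ v ∈ S, dist u v ≤ 1 + 1 / 400 → ((∀ w ∈ S, w ≠ v → 1 - 1 / 400 ≤ dist v w ∧ (dist v w ≤ 1 + 1 / 400 ∨ 63 / 50 ≤ dist v w)) ∧ {w ∈ S | w ≠ v ∧ dist v w ≤ 1 + 1 / 400}.ncard = 12)) → ((∃ e : {w : EuclideanSpace ℝ (Fin 3) // w ∈ S ∧ w ≠ u ∧ dist u w ≤ 1 + 1 / 400} ≃ {q : EuclideanSpace ℝ (Fin 3) // q ∈ Literature.Geometry.DiscreteGeometry.fccKissingPattern}, ∀ w w' : {w : EuclideanSpace ℝ (Fin 3) // w ∈ S ∧ w ≠ u ∧ dist u w ≤ 1 + 1 / 400}, w ≠ w' → (dist w.1 w'.1 ≤ 1 + 1 / 400 ↔ dist (e w).1 (e w').1 = 1)) ∨ (∃ e : {w : EuclideanSpace ℝ (Fin 3) // w ∈ S ∧ w ≠ u ∧ dist u w ≤ 1 + 1 / 400} ≃ {q : EuclideanSpace ℝ (Fin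 3) // q ∈ Literature.Geometry.DiscreteGeometry.hcpKissingPattern}, ∀ w w' : {w : EuclideanSpace ℝ (Fin 3) // w ∈ S ∧ w ≠ u ∧ dist u w ≤ 1 + 1 / 400}, w ≠ w' → (dist w.1 w'.1 ≤ 1 + 1 / 400 ↔ dist (e w).1 (e w').1 = 1)))) → (∀ (S : Set (EuclideanSpace ℝ (Fin 3))) (u : EuclideanSpace ℝ (Fin 3)), u ∈ S → (∀ v ∈ S, dist u v ≤ 13 / 5 → ((∀ w ∈ S, w ≠ v → 1 - 1 / 4000 ≤ dist v w ∧ (dist v w ≤ 1 + 1 / 4000 ∨ 131 / 100 ≤ dist v w)) ∧ {w ∈ S | w ≠ v ∧ dist v w ≤ 1 + 1 / 4000}.ncard = 12)) → ∀ (P : Finset (EuclideanSpace ℝ (Fin 3))), (P = Literature.Geometry.DiscreteGeometry.fccKissingPattern ∨ P = Literature.Geometry.DiscreteGeometry.hcpKissingPattern) → ∀ (e : {w : EuclideanSpace ℝ (Fin 3) // w ∈ S ∧ w ≠ u ∧ dist u w ≤ 1 + 1 / 400} ≃ {q : EuclideanSpace ℝ (Fin 3) // q ∈ P}), (∀ w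 w' : {w : EuclideanSpace ℝ (Fin 3) // w ∈ S ∧ w ≠ u ∧ dist u w ≤ 1 + 1 / 400}, w ≠ w' → (dist w.1 w'.1 ≤ 1 + 1 / 400 ↔ dist (e w).1 (e w').1 = 1)) → (∀ z₁ ∈ S, ∀ z₂ ∈ S, ∀ z₃ ∈ S, ∀ z₄ ∈ S, z₁ ≠ u → z₂ ≠ u → z₃ ≠ u → z₄ ≠ u → dist u z₁ ≤ 1 + 1 / 4000 → dist u z₂ ≤ 1 + 1 / 4000 → dist u z₃ ≤ 1 + 1 / 4000 → dist u z₄ ≤ 1 + 1 / 4000 → dist z₁ z₂ ≤ 1 + 1 / 4000 → dist z₂ z₃ ≤ 1 + 1 / 4000 → dist z₃ z₄ ≤ 1 + 1 / 4000 → dist z₄ z₁ ≤ 1 + 1 / 4000 → ¬ dist z₁ z₃ ≤ 1 + 1 / 4000 → ¬ dist z₂ z₄ ≤ 1 + 1 / 4000 → ∃ w ∈ S, w ≠ u ∧ dist w z₁ ≤ 1 + 1 / 4000 ∧ dist w z₂ ≤ 1 + 1 / 4000 ∧ dist w z₃ ≤ 1 + 1 / 4000 ∧ dist w z₄ ≤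 1 + 1 / 4000) → (∀ (η : ℝ) (u w z₁ z₂ z₃ z₄ : EuclideanSpace ℝ (Fin 3)), 0 ≤ η → η ≤ 1 / 1000 → 1 - η ≤ dist u z₁ → dist u z₁ ≤ 1 + η → 1 - η ≤ dist u z₂ → dist u z₂ ≤ 1 + η → 1 - η ≤ dist u z₃ → dist u z₃ ≤ 1 + η → 1 - η ≤ dist u z₄ → dist u z₄ ≤ 1 + η → 1 - η ≤ dist w z₁ → dist w z₁ ≤ 1 + η → 1 - η ≤ dist w z₂ → dist w z₂ ≤ 1 + η → 1 - η ≤ dist w z₃ → dist w z₃ ≤ 1 + η → 1 - η ≤ dist w z₄ → dist w z₄ ≤ 1 + η → 1 - η ≤ dist z₁ z₂ → dist z₁ z₂ ≤ 1 + η → 1 - η ≤ dist z₂ z₃ → dist z₂ z₃ ≤ 1 + η → 1 - η ≤ dist z₃ z₄ → dist z₃ z₄ ≤ 1 + η → 1 - η ≤ dist z₄ z₁ → dist z₄ z₁ ≤ 1 + η → 131 / 100 ≤ dist z₁ z₃ → 131 / 100 ≤ dist z₂ z₄ → 131 / 100 ≤ dist u w → |dist z₁ z₃ ^ 2 - 2|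 ≤ 38 * η ∧ |dist z₂ z₄ ^ 2 - 2| ≤ 38 * η ∧ |dist u w ^ 2 - 2| ≤ 29 * η) → (∀ (η : ℝ) (p c n₁ n₂ n₃ n₄ : EuclideanSpace ℝ (Fin 3)), 0 ≤ η → η ≤ 1 / 1000 → 1 - η ≤ dist c p → dist c p ≤ 1 + η → 1 - η ≤ dist p n₁ → dist p n₁ ≤ 1 + η → 1 - η ≤ dist p n₂ → dist p n₂ ≤ 1 + η → 1 - η ≤ dist p n₃ → dist p n₃ ≤ 1 + η → 1 - η ≤ dist p n₄ → dist p n₄ ≤ 1 + η → 1 - η ≤ dist c n₁ → dist c n₁ ≤ 1 + η → 1 - η ≤ dist c n₂ → dist c n₂ ≤ 1 + η → 1 - η ≤ dist c n₃ → dist c n₃ ≤ 1 + η → 1 - η ≤ dist c n₄ → dist c n₄ ≤ 1 + η → 1 - η ≤ dist n₁ n₂ → dist n₁ n₂ ≤ 1 + η → 1 - η ≤ dist n₃ n₄ → dist n₃ n₄ ≤ 1 + η → |dist n₂ n₃ ^ 2 - 2| ≤ 38 * η → |dist n₄ n₁ ^ 2 - 2| ≤ 38 * η → 131 / 100 ≤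 dist n₁ n₃ → 131 / 100 ≤ dist n₂ n₄ → |dist n₁ n₃ ^ 2 - 3| ≤ 40 * η ∧ |dist n₂ n₄ ^ 2 - 3| ≤ 40 * η) → (∀ (η : ℝ) (p c n₁ n₂ n₃ n₄ : EuclideanSpace ℝ (Fin 3)), 0 ≤ η → η ≤ 1 / 1000 → 1 - η ≤ dist c p → dist c p ≤ 1 + η → 1 - η ≤ dist p n₁ → dist p n₁ ≤ 1 + η → 1 - η ≤ dist p n₂ → dist p n₂ ≤ 1 + η → 1 - η ≤ dist p n₃ → dist p n₃ ≤ 1 + η → 1 - η ≤ dist p n₄ → dist p n₄ ≤ 1 + η → 1 - η ≤ dist c n₁ → dist c n₁ ≤ 1 + η → 1 - η ≤ dist c n₂ → dist c n₂ ≤ 1 + η → 1 - η ≤ dist c n₃ → dist c n₃ ≤ 1 + η → 1 - η ≤ dist c n₄ → dist c n₄ ≤ 1 + η → 1 - η ≤ dist n₁ n₂ → dist n₁ n₂ ≤ 1 + η → 1 - η ≤ dist n₂ n₃ → dist n₂ n₃ ≤ 1 + η → |dist n₃ n₄ ^ 2 - 2| ≤ 38 * η → |dist n₄ n₁ ^ 2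 - 2| ≤ 38 * η → 131 / 100 ≤ dist n₁ n₃ → 131 / 100 ≤ dist n₂ n₄ → |dist n₁ n₃ ^ 2 - 8 / 3| ≤ 60 * η ∧ |dist n₂ n₄ ^ 2 - 3| ≤ 40 * η) → ((∀ t t' : {w : EuclideanSpace ℝ (Fin 3) // w ∈ S ∧ w ≠ u ∧ dist u w ≤ 1 + 1 / 400}, dist (e t).1 (e t').1 = Real.sqrt 2 → |dist t.1 t'.1 ^ 2 - 2| ≤ 38 / 4000) ∧ (∀ t t' : {w : EuclideanSpace ℝ (Fin 3) // w ∈ S ∧ w ≠ u ∧ dist u w ≤ 1 + 1 / 400}, dist (e t).1 (e t').1 = Real.sqrt 3 → |dist t.1 t'.1 ^ 2 - 3| ≤ 40 / 4000) ∧ (∀ t t' : {w : EuclideanSpace ℝ (Fin 3) // w ∈ S ∧ w ≠ u ∧ dist u w ≤ 1 + 1 / 400}, dist (e t).1 (e t').1 = Real.sqrt (8 / 3) → |dist t.1 t'.1 ^ 2 - 8 / 3| ≤ 60 / 4000))) → (∀ (u : EuclideanSpace ℝ (Fin 3)) (τ : {q : EuclideanSpace ℝ (Fin 3) // q ∈ Literature.Geometry.DiscreteGeometry.fccKissingPattern}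 → EuclideanSpace ℝ (Fin 3)), (∀ q : {q : EuclideanSpace ℝ (Fin 3) // q ∈ Literature.Geometry.DiscreteGeometry.fccKissingPattern}, 1 - 1 / 4000 ≤ dist u (τ q) ∧ dist u (τ q) ≤ 1 + 1 / 4000) → (∀ q q' : {q : EuclideanSpace ℝ (Fin 3) // q ∈ Literature.Geometry.DiscreteGeometry.fccKissingPattern}, dist q.1 q'.1 = 1 → 1 - 1 / 4000 ≤ dist (τ q) (τ q') ∧ dist (τ q) (τ q') ≤ 1 + 1 / 4000) → (∀ q q' : {q : EuclideanSpace ℝ (Fin 3) // q ∈ Literature.Geometry.DiscreteGeometry.fccKissingPattern}, dist q.1 q'.1 = Real.sqrt 2 → |dist (τ q) (τ q') ^ 2 - 2| ≤ 38 / 4000) → (∀ q q' : {q : EuclideanSpace ℝ (Fin 3) // q ∈ Literature.Geometry.DiscreteGeometry.fccKissingPattern}, dist q.1 q'.1 = Real.sqrt 3 → |dist (τ q) (τ q') ^ 2 - 3| ≤ 40 / 4000) → ∃ A : EuclideanSpace ℝ (Fin 3) →ₗᵢ[ℝ] EuclideanSpace ℝ (Fin 3), ∀ q : {q : EuclideanSpace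 ℝ (Fin 3) // q ∈ Literature.Geometry.DiscreteGeometry.fccKissingPattern}, ‖(τ q - u) - A q.1‖ ≤ 49 / 1000) → (∀ (u : EuclideanSpace ℝ (Fin 3)) (τ : {q : EuclideanSpace ℝ (Fin 3) // q ∈ Literature.Geometry.DiscreteGeometry.hcpKissingPattern} → EuclideanSpace ℝ (Fin 3)), (∀ q : {q : EuclideanSpace ℝ (Fin 3) // q ∈ Literature.Geometry.DiscreteGeometry.hcpKissingPattern}, 1 - 1 / 4000 ≤ dist u (τ q) ∧ dist u (τ q) ≤ 1 + 1 / 4000) → (∀ q q' : {q : EuclideanSpace ℝ (Fin 3) // q ∈ Literature.Geometry.DiscreteGeometry.hcpKissingPattern}, dist q.1 q'.1 = 1 → 1 - 1 / 4000 ≤ dist (τ q) (τ q') ∧ dist (τ q) (τ q') ≤ 1 + 1 / 4000) → (∀ q q' : {q : EuclideanSpace ℝ (Fin 3) // q ∈ Literature.Geometry.DiscreteGeometry.hcpKissingPattern}, dist q.1 q'.1 = Real.sqrt 2 → |dist (τ q) (τ q') ^ 2 - 2| ≤ 38 / 4000) → (∀ q q' : {q : EuclideanSpace ℝ (Fin 3)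 // q ∈ Literature.Geometry.DiscreteGeometry.hcpKissingPattern}, dist q.1 q'.1 = Real.sqrt 3 → |dist (τ q) (τ q') ^ 2 - 3| ≤ 40 / 4000) → (∀ q q' : {q : EuclideanSpace ℝ (Fin 3) // q ∈ Literature.Geometry.DiscreteGeometry.hcpKissingPattern}, dist q.1 q'.1 = Real.sqrt (8 / 3) → |dist (τ q) (τ q') ^ 2 - 8 / 3| ≤ 60 / 4000) → ∃ A : EuclideanSpace ℝ (Fin 3) →ₗᵢ[ℝ] EuclideanSpace ℝ (Fin 3), ∀ q : {q : EuclideanSpace ℝ (Fin 3) // q ∈ Literature.Geometry.DiscreteGeometry.hcpKissingPattern}, ‖(τ q - u) - A q.1‖ ≤ 49 / 1000) → Summit.AtomisticToContinuum.Crystallization.Theses.HullExactificationCascade.ZeroDefectDensity := by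
  intro hSKO hLHK hPins hCF hCH x hx
  refine tendsto_density_mono
    (P := fun N i => ¬ Summit.AtomisticToContinuum.Crystallization.Theorems.SiteGood (Set.range (x N)) (x N i))
    ?_ (hSKO x hx)
  intro N i hi hgood
  exact hi (red_siteGood_of_softKissedNbhd hLHK hPins hCF hCH (Set.range (x N)) (x N i) ⟨i, rfl⟩ hgood)

/-- `red_lhk_hypotheses`, registered sub-goal form (lands this file). [folklore] -/
theorem red_lhk_hypotheses' : ∀ (S : Set (EuclideanSpace ℝ (Fin 3))) (u : EuclideanSpace ℝ (Fin 3)), (∀ v ∈ S, dist u v ≤ 13 / 5 → ((∀ w ∈ S, w ≠ v → 1 - 1 / 4000 ≤ dist v w ∧ (dist v w ≤ 1 + 1 / 4000 ∨ 131 / 100 ≤ dist v w)) ∧ {w ∈ S | w ≠ v ∧ dist v w ≤ 1 + 1 / 4000}.ncard = 12)) → ∀ (z : EuclideanSpace ℝ (Fin 3)), (z = u ∨ (z ∈ S ∧ dist u z ≤ 1 + 1 / 4000)) → ∀ v ∈ S, dist z v ≤ 1 + 1 / 400 → ((∀ w ∈ S, w ≠ v → 1 - 1 / 400 ≤ dist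 v w ∧ (dist v w ≤ 1 + 1 / 400 ∨ 63 / 50 ≤ dist v w)) ∧ {w ∈ S | w ≠ v ∧ dist v w ≤ 1 + 1 / 400}.ncard = 12) :=
  fun S u hS z hz => red_lhk_hypotheses S u hS z hz

end Summit.AtomisticToContinuum.Crystallization.Theorems.ZeroDefectDensityBirth

end
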